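import Summits.Ventures.HodgeRepro2.T5FinitePlaceStar
import Summits.Ventures.HodgeRepro2.T5QuadraticStarNorm

/-!
# `E_w = F_v + F_v √θ` at a non-split place, and O'Meara §65A on `F_v` itself (cell pub-hodge-repro2, seat p3)

Tier-5 N2 support, rows N2.2.2 / N2.8.1 of route/T5-N2-route-3.md, the instantiation of files 133–137 on the
route's own local fields (files 115–120): at a finite place `v` of `F` NON-split in `E = F(√θ)` (`θ` not a
`v`-adic square), the completion `E_w` with file 119's `localStarRing` (star = the local conjugation) is a
quadratic star algebra over `F_v` in the sense of file 137:
* `exists_eq_add_mul_s`: every `y ∈ E_w` is `a + b √θ` with `a, b ∈ F_v` (through file 117's `E_w = F_v ⊗_F E`);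
* **`isQuadraticStar_local`**: `IsQuadraticStar (√θ : E_w)`;
* `algebraMap_s_mul_self`: `(√θ)² = θ` in `E_w`; `selfAdjointEquiv : F_v ≃+* selfAdjoint E_w` (file 119's
  «star y = y ↔ y ∈ F_v»);
* **`hilbertSolvable_iff_isUnitNorm_local`**: for `a ∈ F_v^×`, `(a, θ)_v = 1` (O'Meara 63:1's equation
  `a ξ² + θ η² = 1` solvable IN `F_v`) iff `a = star u · u` for a unit `u` of `E_w` — O'Meara §65A p0180 ll. 19–21
  «α ∈ Ḟ_𝔭 is a local norm at 𝔭 iff (α, θ/𝔭) = 1», now with `α ∈ F_v`, the norm in `E_w`, and the symbol on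
  `F_v`, all as the route's objects.
With file 136 (modulo `(U)`) this closes row N2.8.1 (i)'s «`W₁₂,v ≅ W₃₄,v ⟺ (c, θ/v) = 1`» at a non-split `v`
at the level of Gram matrices over `E_w`. Mathlib + files 115–119, 133, 134, 137 only. No display; no device.
§8(d): uses an L-value-free non-vanishing device: NO.
-/

namespace Summit.Ventures.HodgeRepro2.T5FinitePlaceQuadraticStar

open IsDedekindDomain IsDedekindDomain.HeightOneSpectrum NumberField Module
open scoped Summit.Ventures.HodgeRepro2.T5FinitePlaceLiesOver
open Summit.Ventures.HodgeRepro2.T5FinitePlaceLiesOver Summit.Ventures.HodgeRepro2.T5FinitePlaceQuadratic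
  Summit.Ventures.HodgeRepro2.T5FinitePlaceTensorEquiv Summit.Ventures.HodgeRepro2.T5FinitePlaceLocalNorm
  Summit.Ventures.HodgeRepro2.T5FinitePlaceStar Summit.Ventures.HodgeRepro2.T5QuadraticStarNorm
  Summit.Ventures.HodgeRepro2.T5HilbertSymbolNorm Summit.Ventures.HodgeRepro2.T5HermitianDetClass

section Transfer

/-- `HilbertSolvable` is invariant under ring isomorphisms. -/
theorem hilbertSolvable_map {F F' : Type*} [Field F] [Field F'] (e : F ≃+* F') (a b : F) :
    HilbertSolvable (e a) (e b) ↔ HilbertSolvable a b := by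
  constructor
  · rintro ⟨ξ, η, h⟩
    refine ⟨e.symm ξ, e.symm η, ?_⟩
    apply e.injective
    rw [map_add, map_mul, map_mul, map_pow, map_pow, RingEquiv.apply_symm_apply, RingEquiv.apply_symm_apply,
      map_one, h]
  · rintro ⟨ξ, η, h⟩
    refine ⟨e ξ, e η, ?_⟩
    rw [← map_pow, ← map_pow, ← map_mul, ← map_mul, ← map_add, h, map_one]

end Transfer

section Local

variable {F E : Type*} [Field F] [NumberField F] [Field E] [NumberField E] [Algebra F E]
  [Algebra.IsQuadraticExtension F E]
variable (v : HeightOneSpectrum (𝓞 F)) (w : HeightOneSpectrum (𝓞 E)) [w.asIdeal.LiesOver v.asIdeal]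
variable {s : E} {θ : F}
variable (hs : s ^ 2 = algebraMap F E θ) (hspan : Submodule.span F {(1 : E), s} = ⊤)
  (hsq : ¬ IsSquare (algebraMap F (v.adicCompletion F) θ)) (c : E ≃ₐ[F] E) (hc : c s = -s)

include hs hspan hsq in
/-- **`E_w = F_v + F_v √θ`**: every element of the completion is `a + b √θ` with `a, b ∈ F_v`. -/
theorem exists_eq_add_mul_s (y : w.adicCompletion E) :
    ∃ a b : v.adicCompletion F, y = algebraMap (v.adicCompletion F) (w.adicCompletion E) a +
      algebraMap (v.adicCompletion F) (w.adicCompletion E) b * algebraMap E (w.adicCompletion E) s := by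
  obtain ⟨t, rfl⟩ := (tensorLiftEquivOfNotIsSquare v w hs hspan hsq).surjective y
  induction t using TensorProduct.induction_on with
  | zero => exact ⟨0, 0, by simp⟩
  | tmul r x =>
    have hx : x ∈ Submodule.span F {(1 : E), s} := hspan ▸ Submodule.mem_top
    obtain ⟨a', b', rfl⟩ := Submodule.mem_span_pair.mp hx
    refine ⟨r * algebraMap F (v.adicCompletion F) a', r * algebraMap F (v.adicCompletion F) b', ?_⟩
    unfold tensorLiftEquivOfNotIsSquare
    rw [tensorLiftEquiv_tmul]
    simp only [Algebra.smul_def, mul_one, map_add, map_mul]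
    rw [← IsScalarTower.algebraMap_apply F E (w.adicCompletion E) a',
      IsScalarTower.algebraMap_apply F (v.adicCompletion F) (w.adicCompletion E) a',
      ← IsScalarTower.algebraMap_apply F E (w.adicCompletion E) b',
      IsScalarTower.algebraMap_apply F (v.adicCompletion F) (w.adicCompletion E) b']
    ring
  | add t₁ t₂ h₁ h₂ =>
    obtain ⟨a₁, b₁, h₁⟩ := h₁
    obtain ⟨a₂, b₂, h₂⟩ := h₂
    refine ⟨a₁ + a₂, b₁ + b₂, ?_⟩
    rw [map_add, h₁, h₂, map_add, map_add]
    ring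

/-- **`E_w` is a quadratic star algebra with generator `√θ`** (file 137's notion) under file 119's star. -/
theorem isQuadraticStar_local :
    letI := localStarRing v w hs hspan hsq c hc
    IsQuadraticStar (algebraMap E (w.adicCompletion E) s) := by
  letI := localStarRing v w hs hspan hsq c hc
  refine ⟨star_algebraMap_s v w hs hspan hsq c hc, fun y => ?_⟩
  obtain ⟨a, b, hy⟩ := exists_eq_add_mul_s v w hs hspan hsq y
  exact ⟨_, _, star_algebraMap_left v w hs hspan hsq c hc a, star_algebraMap_left v w hs hspan hsq c hc b, hy⟩

omit [Algebra.IsQuadraticExtension F E] in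
include hs in
/-- `(√θ)² = θ` in `E_w`. -/
theorem algebraMap_s_mul_self :
    algebraMap E (w.adicCompletion E) s * algebraMap E (w.adicCompletion E) s =
      algebraMap (v.adicCompletion F) (w.adicCompletion E) (algebraMap F (v.adicCompletion F) θ) := by
  rw [← map_mul, ← sq, hs, ← IsScalarTower.algebraMap_apply F E (w.adicCompletion E),
    IsScalarTower.algebraMap_apply F (v.adicCompletion F) (w.adicCompletion E)]

include hsq in
/-- `θ ≠ 0` in `F_v` (it is not a square there). -/
theorem algebraMap_theta_ne_zero : algebraMap F (v.adicCompletion F) θ ≠ 0 := by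
  intro h
  apply hsq
  rw [h]
  exact ⟨0, by ring⟩

/-- The inclusion `F_v → selfAdjoint E_w` as a ring homomorphism. -/
noncomputable def selfAdjointHom :
    letI := localStarRing v w hs hspan hsq c hc
    v.adicCompletion F →+* selfAdjoint (w.adicCompletion E) :=
  letI := localStarRing v w hs hspan hsq c hc
  { toFun := fun a => ⟨algebraMap (v.adicCompletion F) (w.adicCompletion E) a,
      isSelfAdjoint_algebraMap_left v w hs hspan hsq c hc a⟩
    map_one' := Subtype.ext (map_one _)
    map_mul' := fun a b => Subtype.ext (map_mul _ a b)
    map_zero' := Subtype.ext (map_zero _)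
    map_add' := fun a b => Subtype.ext (map_add _ a b) }

/-- `selfAdjointHom` is bijective: injective as a field homomorphism, surjective by file 119's
«star y = y ↔ y ∈ F_v». -/
theorem selfAdjointHom_bijective :
    letI := localStarRing v w hs hspan hsq c hc
    Function.Bijective (selfAdjointHom v w hs hspan hsq c hc) := by
  letI := localStarRing v w hs hspan hsq c hc
  constructor
  · intro a b hab
    exact (algebraMap (v.adicCompletion F) (w.adicCompletion E)).injective (congrArg Subtype.val hab)
  · rintro ⟨y, hy⟩
    obtain ⟨a, rfl⟩ := (isSelfAdjoint_iff v w hs hspan hsq c hc y).mp hy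
    exact ⟨a, rfl⟩

/-- **`F_v ≃ selfAdjoint E_w`**: the self-adjoint subfield of `E_w` is `F_v`. -/
noncomputable def selfAdjointEquiv :
    letI := localStarRing v w hs hspan hsq c hc
    v.adicCompletion F ≃+* selfAdjoint (w.adicCompletion E) :=
  letI := localStarRing v w hs hspan hsq c hc
  RingEquiv.ofBijective (selfAdjointHom v w hs hspan hsq c hc) (selfAdjointHom_bijective v w hs hspan hsq c hc)

/-- The value of `selfAdjointEquiv`. -/
theorem selfAdjointEquiv_apply (a : v.adicCompletion F) :
    letI := localStarRing v w hs hspan hsq c hc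
    ((selfAdjointEquiv v w hs hspan hsq c hc a : selfAdjoint (w.adicCompletion E)) :
      w.adicCompletion E) = algebraMap (v.adicCompletion F) (w.adicCompletion E) a := rfl

/-- **O'Meara §65A on the route's local fields**: for `a ∈ F_v^×` at a place `v` non-split in `E = F(√θ)`,
`(a, θ)_v = 1` — i.e. `a ξ² + θ η² = 1` has a solution in `F_v` — iff `a = star u · u` for a unit `u ∈ E_w`
(the local norm from `E_w`, with file 119's conjugation as `star`). -/
theorem hilbertSolvable_iff_isUnitNorm_local (a : v.adicCompletion F) (ha : a ≠ 0) :
    letI := localStarRing v w hs hspan hsq c hc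
    HilbertSolvable a (algebraMap F (v.adicCompletion F) θ) ↔
      IsUnitNorm (algebraMap (v.adicCompletion F) (w.adicCompletion E) a) := by
  letI := localStarRing v w hs hspan hsq c hc
  haveI : CharZero (w.adicCompletion E) :=
    charZero_of_injective_algebraMap (algebraMap ℚ (w.adicCompletion E)).injective
  have h2 : (2 : w.adicCompletion E) ≠ 0 := two_ne_zero
  have hθ0 : algebraMap F (v.adicCompletion F) θ ≠ 0 := algebraMap_theta_ne_zero v hsq
  set e := selfAdjointEquiv v w hs hspan hsq c hc with he
  have hθ' : e (algebraMap F (v.adicCompletion F) θ) ≠ 0 := by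
    rw [map_ne_zero]
    exact hθ0
  have ha' : e a ≠ 0 := by
    rw [map_ne_zero]
    exact ha
  have hθs : ((e (algebraMap F (v.adicCompletion F) θ) : selfAdjoint (w.adicCompletion E)) :
      w.adicCompletion E) = algebraMap E (w.adicCompletion E) s * algebraMap E (w.adicCompletion E) s := by
    rw [he, selfAdjointEquiv_apply, algebraMap_s_mul_self v w hs]
  rw [← hilbertSolvable_map e, hilbertSolvable_iff_isUnitNorm (isQuadraticStar_local v w hs hspan hsq c hc) h2
    hθs hθ' ha', he, selfAdjointEquiv_apply]

end Local

end Summit.Ventures.HodgeRepro2.T5FinitePlaceQuadraticStar
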